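import Summits.CriticalPhenomena.CardyFormulaZ2.Theorems.CardyFlipRussoVoronoiHubFromSmirnovInsensitivity

/-!
# Stub `insensitivity_sdiffLaw` of line `moebius-exact-delaunay-dilation-ward`
# (crux `VoronoiHubFromSmirnov`, stmt-CriticalPhenomena-6433)

The removal form of the Insensitivity Lemma of Benjamini–Schramm (I. Benjamini, O. Schramm,
*Conformal invariance of Voronoi percolation*, Comm. Math. Phys. 197 (1998) 75–107, Corollary 8.2),
in its finite form.

On the subsets of a finite type `X` with `n = |X|` elements let `η` be the `p`-Bernoulli product
law, `η(a) = p^|a| (1-p)^(n-|a|)` (`0 < p < 1`), and let `ν` be any probability law.  The law of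
`ω \ Z` with `ω ∼ η` and `Z ∼ ν` independent is `a ↦ Σ_{b \ c = a} η(b) ν(c)`, and

`Σ_a |Σ_{b \ c = a} η(b) ν(c) − η(a)| ≤ √( Σ_{b,c} ν(b) ν(c) (1-p)^{-|b ∩ c|} − 1 )`.

Proof (loc. cit.: "use `η ∩ Zᶜ = (ηᶜ ∪ Z)ᶜ` and apply the lemma").  Complementation `a ↦ aᶜ` is a
bijection of `Finset X` carrying the `p`-Bernoulli weights to the `(1-p)`-Bernoulli weights,
`(1-p)^|aᶜ| p^(n-|aᶜ|) = p^|a| (1-p)^(n-|a|)` (`Finset.card_compl`), and `bᶜ ∪ c = aᶜ ↔ b \ c = a`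
(`(b \ c)ᶜ = bᶜ ∪ c`).  Reindexing the outer sum over `a` and the inner sum over `b` by
complementation (`Fintype.sum_bijective`, `compl_bijective`) turns the left side into the left side
of the landed union form `insensitivity_unionLaw` at the parameter `1 - p` with the same `ν`; the
right sides agree literally (`(1 - p)⁻¹`).

No new definitions; Mathlib and the landed union form only.
-/

noncomputable section

namespace Summit.CriticalPhenomena.CardyFormulaZ2.Cruxes.VoronoiHubFromSmirnov.MoebiusExactDelaunayDilationWard

open Finset

variable {X : Type} [Fintype X] [DecidableEq X]

omit [Fintype X] in
/-- The complement of a difference: `(b \ c)ᶜ = bᶜ ∪ c` needs a top element, so it is stated through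
membership: `x ∉ b \ c ↔ x ∉ b ∨ x ∈ c`. -/
theorem insr_not_mem_sdiff_iff (b c : Finset X) (x : X) : x ∉ b \ c ↔ x ∉ b ∨ x ∈ c := by
  rw [Finset.mem_sdiff, not_and_or, not_not]

/-- The complement of a difference of finsets of a finite type: `(b \ c)ᶜ = bᶜ ∪ c`. -/
theorem insr_compl_sdiff (b c : Finset X) : (b \ c)ᶜ = bᶜ ∪ c := by
  ext x
  rw [Finset.mem_compl, Finset.mem_union, Finset.mem_compl, insr_not_mem_sdiff_iff]

/-- Complementation exchanges removal and union: `bᶜ ∪ c = aᶜ ↔ b \ c = a`. -/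
theorem insr_compl_union_eq_compl_iff (a b c : Finset X) : bᶜ ∪ c = aᶜ ↔ b \ c = a := by
  rw [← insr_compl_sdiff, compl_inj_iff]

/-- Complementation carries the `(1-p)`-Bernoulli weights to the `p`-Bernoulli weights:
`(1-p)^|aᶜ| (1-(1-p))^(n-|aᶜ|) = p^|a| (1-p)^(n-|a|)`. -/
theorem insr_eta_compl (p : ℝ) (a : Finset X) :
    (1 - p) ^ aᶜ.card * (1 - (1 - p)) ^ (Fintype.card X - aᶜ.card)
      = p ^ a.card * (1 - p) ^ (Fintype.card X - a.card) := by
  rw [Finset.card_compl, Nat.sub_sub_self (Finset.card_le_univ a), sub_sub_cancel, mul_comm]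

/-- The removal law at `a` is the union law (at parameter `1 - p`) at `aᶜ`: reindex the sum over
`b` by complementation. -/
theorem insr_sdiffLaw_eq_unionLaw_compl (p : ℝ) (ν : Finset X → ℝ) (a : Finset X) :
    (∑ b : Finset X, ∑ c : Finset X,
        if b \ c = a then p ^ b.card * (1 - p) ^ (Fintype.card X - b.card) * ν c else 0)
      = ∑ b : Finset X, ∑ c : Finset X,
        if b ∪ c = aᶜ then
          (1 - p) ^ b.card * (1 - (1 - p)) ^ (Fintype.card X - b.card) * ν c else 0 := by
  refine Fintype.sum_bijective _ compl_bijective _ _ fun b => ?_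
  refine Finset.sum_congr rfl fun c _ => ?_
  simp only [insr_compl_union_eq_compl_iff, insr_eta_compl]

/-- **Insensitivity Lemma, removal form** (Benjamini–Schramm 1998, Corollary 8.2), finite form:
for the `p`-Bernoulli product law `η` on the subsets of a finite type and any probability law `ν`,
the `ℓ¹` distance between the law of `ω \ Z` (`ω ∼ η`, `Z ∼ ν` independent) and `η` is at most
`√(E_{ν ⊗ ν} (1-p)^{-|b ∩ c|} − 1)`. -/
theorem insensitivity_sdiffLaw : ∀ {X : Type} [Fintype X] [DecidableEq X] (p : ℝ), 0 < p → p < 1 → ∀ ν : Finset X → ℝ, (∀ b, 0 ≤ ν b) → ∑ b, ν b = 1 → ∑ a : Finset X, |(∑ b : Finset X, ∑ c : Finset X, if b \ c = a then p ^ b.card * (1 - p) ^ (Fintype.card X - b.card) * ν c else 0) - p ^ a.card * (1 - p) ^ (Fintype.card X - a.card)| ≤ Real.sqrt ((∑ b : Finset X, ∑ c : Finset X, ν b * ν c * (1 - p)⁻¹ ^ (b ∩ c).card) - 1) := by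
  intro X _ _ p hp0 hp1 ν hν0 hν1
  have key := insensitivity_unionLaw (1 - p) (sub_pos.mpr hp1) (sub_lt_self 1 hp0) ν hν0 hν1
  refine le_of_eq_of_le ?_ key
  refine Fintype.sum_bijective _ compl_bijective _ _ fun a => ?_
  rw [insr_sdiffLaw_eq_unionLaw_compl, insr_eta_compl]

end Summit.CriticalPhenomena.CardyFormulaZ2.Cruxes.VoronoiHubFromSmirnov.MoebiusExactDelaunayDilationWard

end
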